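import Mathlib.Analysis.Normed.Field.Krasner
import Mathlib.Analysis.Normed.Group.Ultra
import Mathlib.FieldTheory.Separable
import Mathlib.Algebra.Polynomial.Splits
import Mathlib.Algebra.Order.BigOperators.Group.Finset

/-!
# Krasner's lemma, corollary: nearby polynomials generate the same extensions

Classical local constancy of the fields generated by the roots of a polynomial over a complete
non-archimedean field (Gouvêa, *p-adic Numbers*, Cor. 6.8.3 of Krasner's lemma Thm. 6.8.2; Cassels,
*Local Fields*, Ch. 7 §3 Cor. 3; the root-continuity half is Gouvêa's Problem 282). Infrastructure towards
the finiteness of the set of subextensions of bounded degree of a `p`-adic field (M. Krasner 1966;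
Bombieri–Gubler, *Heights*, proof of Prop. 4.5.3), filed for the abc-iut cell (campaign S, named fact
`krasner_finite_subextensions` of abc-iut-S4) by seat abc-iut-L6-d1; Mathlib supplies Krasner's lemma itself
(`IsKrasner.of_completeSpace`).

Setting: `L` a normed field with an ultrametric norm (for the root calculus), later a normed algebra over a
field `K` with `IsKrasner K L` (e.g. `K = ℚ_[p]`, `L = PadicAlgCl p`). Polynomials are compared through
their coefficients (`∀ i, ‖F.coeff i - G.coeff i‖ ≤ ε`); no topology on `K[X]` is used.

Main results (all for MONIC `F`, `G` of the same degree `n ≥ 1` that split in `L` with roots in the closed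
unit ball, `F` with simple roots pairwise at distance `≥ δ`, and coefficients within `ε < δ ^ n`):
* `exists_root_near_of_coeff_near`, `exists_root_near_of_coeff_near'` — root continuity in both directions;
* `map_nearestRoot_eq_roots` — the matching `G.roots → F.roots` is a bijection of multisets; hence
  `nodup_roots_of_coeff_near` (`G` has simple roots) and `le_norm_sub_of_coeff_near` (the roots of `G` are
  again pairwise at distance `≥ δ`);
* `adjoin_eq_adjoin_of_coeff_near` — for `f g : K[X]` as above and `β` a root of `g` matched with the root
  `α` of `f`: `K⟮β⟯ = K⟮α⟯` (Krasner's lemma applied in both directions), and `separable_of_coeff_near`.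
-/

open Polynomial IntermediateField

namespace Literature.NumberTheory.LocalFields

/-! ### Root calculus in an ultrametric normed field -/

section RootCalculus

variable {L : Type*} [NormedField L]

/-- `‖∏ m‖ = ∏ ‖·‖` over a multiset (the norm of a field is multiplicative).
[cite: Gouvea1993PadicNumbers, Cor 6.8.3] -/
theorem norm_multiset_prod (m : Multiset L) : ‖m.prod‖ = (m.map (‖·‖)).prod := by
  induction m using Multiset.induction_on with
  | empty => simp
  | cons a m ih => simp [ih]

/-- For a monic split `G`: `‖G(x)‖ = ∏_{b root} ‖x - b‖` (roots with multiplicity).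
[cite: Gouvea1993PadicNumbers, Cor 6.8.3] -/
theorem norm_eval_eq_prod_roots {G : L[X]} (hG : G.Splits) (hm : G.Monic) (x : L) :
    ‖G.eval x‖ = (G.roots.map fun b => ‖x - b‖).prod := by
  rw [hG.eval_eq_prod_roots_of_monic hm, norm_multiset_prod, Multiset.map_map]
  rfl

/-- Elementary: a product of reals each `≥ δ ≥ 0` is `≥ δ ^ (number of factors)`.
[cite: Gouvea1993PadicNumbers, Cor 6.8.3] -/
theorem pow_card_le_multiset_prod {m : Multiset ℝ} {δ : ℝ} (hδ : 0 ≤ δ) (h : ∀ r ∈ m, δ ≤ r) :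
    δ ^ Multiset.card m ≤ m.prod := by
  induction m using Multiset.induction_on with
  | empty => simp
  | cons a m ih =>
    rw [Multiset.card_cons, pow_succ, Multiset.prod_cons, mul_comm (δ ^ _) δ]
    have ha : δ ≤ a := h a (Multiset.mem_cons_self a m)
    exact mul_le_mul ha (ih fun r hr => h r (Multiset.mem_cons_of_mem hr)) (pow_nonneg hδ _)
      (hδ.trans ha)

/-- Root continuity, pointwise form: for a monic split `G` of degree `n ≥ 1` and any `x`, some root `b`
of `G` satisfies `‖x - b‖ ^ n ≤ ‖G(x)‖` (Gouvêa, Problem 282). [cite: Gouvea1993PadicNumbers, Cor 6.8.3] -/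
theorem exists_root_norm_sub_pow_le {G : L[X]} (hG : G.Splits) (hm : G.Monic) (hdeg : G.natDegree ≠ 0)
    (x : L) : ∃ b ∈ G.roots, ‖x - b‖ ^ G.natDegree ≤ ‖G.eval x‖ := by
  classical
  have hne : G.roots.toFinset.Nonempty := by
    rw [Multiset.toFinset_nonempty]; exact hG.roots_ne_zero hdeg
  obtain ⟨b, hb, hmin⟩ := G.roots.toFinset.exists_min_image (fun b => ‖x - b‖) hne
  refine ⟨b, Multiset.mem_toFinset.mp hb, ?_⟩
  have hcard : Multiset.card (G.roots.map fun b => ‖x - b‖) = G.natDegree := by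
    rw [Multiset.card_map, hG.natDegree_eq_card_roots]
  rw [norm_eval_eq_prod_roots hG hm, ← hcard]
  exact pow_card_le_multiset_prod (norm_nonneg _) fun r hr => by
    obtain ⟨b', hb', rfl⟩ := Multiset.mem_map.mp hr
    exact hmin b' (Multiset.mem_toFinset.mpr hb')

variable [IsUltrametricDist L]

/-- Ultrametric bound for polynomial values on the unit ball: if every coefficient of `P` has norm `≤ ε`
and `‖x‖ ≤ 1` then `‖P(x)‖ ≤ ε`. [cite: Gouvea1993PadicNumbers, Cor 6.8.3] -/
theorem norm_eval_le_of_coeff_le {P : L[X]} {ε : ℝ} (hε : 0 ≤ ε) (hP : ∀ i, ‖P.coeff i‖ ≤ ε) {x : L}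
    (hx : ‖x‖ ≤ 1) : ‖P.eval x‖ ≤ ε := by
  rw [eval_eq_sum_range]
  apply IsUltrametricDist.norm_sum_le_of_forall_le_of_nonneg hε
  intro i _
  rw [norm_mul, norm_pow]
  exact (mul_le_of_le_one_right (norm_nonneg _) (pow_le_one₀ (norm_nonneg _) hx)).trans (hP i)

/-- Roots of a monic polynomial with coefficients in the closed unit ball lie in the closed unit ball
(integrality). [cite: Gouvea1993PadicNumbers, Cor 6.8.3] -/
theorem norm_root_le_one {G : L[X]} (hm : G.Monic) (hG : ∀ i, ‖G.coeff i‖ ≤ 1) {x : L}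
    (hx : G.eval x = 0) : ‖x‖ ≤ 1 := by
  by_contra h
  push Not at h
  have hsum : G.eval x = (∑ i ∈ Finset.range G.natDegree, G.coeff i * x ^ i) + x ^ G.natDegree := by
    rw [eval_eq_sum_range, Finset.sum_range_succ, hm.coeff_natDegree, one_mul]
  rcases Nat.eq_zero_or_pos G.natDegree with h0 | hpos
  · rw [hx, h0, Finset.sum_range_zero, pow_zero, zero_add] at hsum
    exact one_ne_zero hsum.symm
  · have hxn : x ^ G.natDegree = -∑ i ∈ Finset.range G.natDegree, G.coeff i * x ^ i :=
      eq_neg_of_add_eq_zero_right (hsum.symm.trans hx)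
    have key : ‖x‖ ^ G.natDegree ≤ ‖x‖ ^ (G.natDegree - 1) := by
      rw [← norm_pow, hxn, norm_neg]
      apply IsUltrametricDist.norm_sum_le_of_forall_le_of_nonneg (by positivity)
      intro i hi
      rw [Finset.mem_range] at hi
      rw [norm_mul, norm_pow]
      calc ‖G.coeff i‖ * ‖x‖ ^ i ≤ 1 * ‖x‖ ^ i := by gcongr; exact hG i
        _ = ‖x‖ ^ i := one_mul _
        _ ≤ ‖x‖ ^ (G.natDegree - 1) := pow_le_pow_right₀ h.le (by omega)
    have h1 : ‖x‖ ^ (G.natDegree - 1) * ‖x‖ ≤ ‖x‖ ^ (G.natDegree - 1) * 1 := by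
      rw [mul_one, ← pow_succ, Nat.sub_add_cancel hpos]; exact key
    have h2 : ‖x‖ ≤ 1 := le_of_mul_le_mul_left h1 (by positivity)
    exact absurd h2 (not_le.mpr h)

/-- In an ultrametric space, a point within `< δ` of `a` is at distance exactly `‖a - a'‖` from any `a'`
with `δ ≤ ‖a - a'‖` ("all triangles are isosceles"). [cite: Gouvea1993PadicNumbers, Thm 6.8.2] -/
theorem norm_sub_eq_of_lt_of_le {b a a' : L} {δ : ℝ} (hb : ‖b - a‖ < δ) (ha' : δ ≤ ‖a - a'‖) :
    ‖b - a'‖ = ‖a - a'‖ := by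
  have hne : ‖b - a‖ ≠ ‖a - a'‖ := (hb.trans_le ha').ne
  have h := IsUltrametricDist.norm_add_eq_max_of_norm_ne_norm hne
  rw [sub_add_sub_cancel] at h
  rw [h, max_eq_right (hb.trans_le ha').le]

end RootCalculus

/-! ### Root matching for polynomials with nearby coefficients -/

section Matching

variable {L : Type*} [NormedField L] [IsUltrametricDist L]
variable {F G : L[X]} {δ ε : ℝ}

/-- Root continuity (Gouvêa, Problem 282 / proof of Cor. 6.8.3): if `F`, `G` are monic of the same degree
`n ≥ 1`, split in `L`, `F` has its roots in the closed unit ball, and the coefficients satisfy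
`‖F_i - G_i‖ ≤ ε < δ ^ n`, then every root of `G` in the closed unit ball lies within `< δ` of a root of `F`.
[cite: Gouvea1993PadicNumbers, Cor 6.8.3] -/
theorem exists_root_near_of_coeff_near (hFm : F.Monic) (hFs : F.Splits) (hdeg : G.natDegree = F.natDegree)
    (hn : F.natDegree ≠ 0) (hδ : 0 < δ) (hε : 0 ≤ ε) (hεδ : ε < δ ^ F.natDegree)
    (hcoeff : ∀ i, ‖F.coeff i - G.coeff i‖ ≤ ε) {b : L} (hb : b ∈ G.roots) (hb1 : ‖b‖ ≤ 1) :
    ∃ a ∈ F.roots, ‖b - a‖ < δ := by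
  have hG0 : G ≠ 0 := by rintro rfl; simp [hn.symm] at hdeg
  have hFb : ‖F.eval b‖ ≤ ε := by
    have : F.eval b = (F - G).eval b := by rw [eval_sub, (mem_roots hG0).mp hb, sub_zero]
    rw [this]
    exact norm_eval_le_of_coeff_le hε (fun i => by rw [coeff_sub]; exact hcoeff i) hb1
  obtain ⟨a, ha, hpow⟩ := exists_root_norm_sub_pow_le hFs hFm hn b
  exact ⟨a, ha, lt_of_pow_lt_pow_left₀ F.natDegree hδ.le (hpow.trans_lt (hFb.trans_lt hεδ))⟩

/-- Root continuity, the other direction: every root of `F` in the closed unit ball lies within `< δ` of a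
root of `G` (same hypotheses, with `G` split). [cite: Gouvea1993PadicNumbers, Cor 6.8.3] -/
theorem exists_root_near_of_coeff_near' (hGm : G.Monic) (hGs : G.Splits) (hdeg : G.natDegree = F.natDegree)
    (hn : F.natDegree ≠ 0) (hδ : 0 < δ) (hε : 0 ≤ ε) (hεδ : ε < δ ^ F.natDegree)
    (hcoeff : ∀ i, ‖F.coeff i - G.coeff i‖ ≤ ε) {a : L} (ha : a ∈ F.roots) (ha1 : ‖a‖ ≤ 1) :
    ∃ b ∈ G.roots, ‖a - b‖ < δ := by
  have hn' : G.natDegree ≠ 0 := hdeg ▸ hn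
  refine exists_root_near_of_coeff_near hGm hGs hdeg.symm hn' hδ hε (hdeg.symm ▸ hεδ)
    (fun i => by rw [norm_sub_rev]; exact hcoeff i) ha ha1

/-- Uniqueness of the nearby root: two roots of `F` within `< δ` of the same point coincide, when distinct
roots of `F` are `≥ δ` apart. [cite: Gouvea1993PadicNumbers, Cor 6.8.3] -/
theorem root_near_unique (hsep : ∀ a ∈ F.roots, ∀ a' ∈ F.roots, a ≠ a' → δ ≤ ‖a - a'‖) {b a a' : L}
    (ha : a ∈ F.roots) (ha' : a' ∈ F.roots) (hba : ‖b - a‖ < δ) (hba' : ‖b - a'‖ < δ) : a = a' := by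
  by_contra hne
  have h := hsep a ha a' ha' hne
  have : ‖a - a'‖ < δ := by
    calc ‖a - a'‖ = ‖(a - b) + (b - a')‖ := by rw [sub_add_sub_cancel]
      _ ≤ max ‖a - b‖ ‖b - a'‖ := IsUltrametricDist.norm_add_le_max _ _
      _ < δ := max_lt (by rwa [norm_sub_rev]) hba'
  exact absurd h (not_le.mpr this)

/-- The multiset matching (Gouvêa, proof of Cor. 6.8.3, counting form): ANY assignment `φ` sending each
root of `G` to a root of `F` within `< δ` reproduces the roots of `F` exactly, with multiplicity — no root
of `F` is missed, none is hit twice. Hypotheses as in `exists_root_near_of_coeff_near`, plus: `F` has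
SIMPLE roots pairwise `≥ δ` apart, and the roots of `G` lie in the closed unit ball.
[cite: Gouvea1993PadicNumbers, Cor 6.8.3] -/
theorem map_nearestRoot_eq_roots (hGm : G.Monic) (hGs : G.Splits) (hFs : F.Splits)
    (hdeg : G.natDegree = F.natDegree) (hFnd : F.roots.Nodup)
    (hsep : ∀ a ∈ F.roots, ∀ a' ∈ F.roots, a ≠ a' → δ ≤ ‖a - a'‖) (hδ : 0 < δ) (hε : 0 ≤ ε)
    (hεδ : ε < δ ^ F.natDegree) (hcoeff : ∀ i, ‖F.coeff i - G.coeff i‖ ≤ ε)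
    (hFr : ∀ a ∈ F.roots, ‖a‖ ≤ 1) {φ : L → L} (hφ : ∀ b ∈ G.roots, φ b ∈ F.roots ∧ ‖b - φ b‖ < δ) :
    G.roots.map φ = F.roots := by
  classical
  have hFcard : Multiset.card F.roots = F.natDegree := hFs.natDegree_eq_card_roots.symm
  have hGcard : Multiset.card G.roots = F.natDegree := by rw [← hdeg]; exact hGs.natDegree_eq_card_roots.symm
  set M := G.roots.map φ with hM
  have hMcard : Multiset.card M = Multiset.card F.roots := by rw [hM, Multiset.card_map, hGcard, hFcard]
  have hMsub : ∀ a ∈ M, a ∈ F.roots := by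
    intro a ha
    obtain ⟨b, hb, rfl⟩ := Multiset.mem_map.mp ha
    exact (hφ b hb).1
  suffices hle : M ≤ F.roots from Multiset.eq_of_le_of_card_le hle hMcard.ge
  by_contra hnle
  rw [Multiset.le_iff_count] at hnle
  push Not at hnle
  obtain ⟨a₀, ha₀⟩ := hnle
  -- counting: some root `a'` of `F` is missed by `φ`
  have hex : ∃ a' ∈ F.roots, a' ∉ M := by
    by_contra hall
    push Not at hall
    have hsum : ∑ a ∈ F.roots.toFinset, M.count a = Multiset.card M :=
      Multiset.sum_count_eq_card (fun a ha => Multiset.mem_toFinset.mpr (hMsub a ha))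
    have hsum' : ∑ a ∈ F.roots.toFinset, F.roots.count a = Multiset.card F.roots :=
      Multiset.toFinset_sum_count_eq _
    have hlt : ∑ a ∈ F.roots.toFinset, F.roots.count a < ∑ a ∈ F.roots.toFinset, M.count a := by
      apply Finset.sum_lt_sum
      · intro a ha
        rw [Multiset.count_eq_one_of_mem hFnd (Multiset.mem_toFinset.mp ha)]
        exact Multiset.one_le_count_iff_mem.mpr (hall a (Multiset.mem_toFinset.mp ha))
      · have ha₀M : a₀ ∈ M := Multiset.count_pos.mp (lt_of_le_of_lt (Nat.zero_le _) ha₀)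
        exact ⟨a₀, Multiset.mem_toFinset.mpr (hMsub a₀ ha₀M), ha₀⟩
    rw [hsum, hsum', hMcard] at hlt
    exact lt_irrefl _ hlt
  obtain ⟨a', ha', ha'M⟩ := hex
  -- every root of `G` is at distance `≥ δ` from the missed root `a'`
  have hfar : ∀ b ∈ G.roots, δ ≤ ‖a' - b‖ := by
    intro b hb
    obtain ⟨hφb, hnear⟩ := hφ b hb
    have hne : φ b ≠ a' := fun h => ha'M (Multiset.mem_map.mpr ⟨b, hb, h⟩)
    rw [norm_sub_rev, norm_sub_eq_of_lt_of_le hnear (hsep _ hφb _ ha' hne)]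
    exact hsep _ hφb _ ha' hne
  -- hence `δ ^ n ≤ ‖G(a')‖`, while `‖G(a')‖ = ‖(G - F)(a')‖ ≤ ε < δ ^ n`
  have hGa : δ ^ F.natDegree ≤ ‖G.eval a'‖ := by
    rw [norm_eval_eq_prod_roots hGs hGm, ← hGcard, ← Multiset.card_map (fun b => ‖a' - b‖) G.roots]
    exact pow_card_le_multiset_prod hδ.le fun r hr => by
      obtain ⟨b, hb, rfl⟩ := Multiset.mem_map.mp hr
      exact hfar b hb
  have hGa' : ‖G.eval a'‖ ≤ ε := by
    have : G.eval a' = (G - F).eval a' := by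
      rw [eval_sub, (isRoot_of_mem_roots ha').eq_zero, sub_zero]
    rw [this]
    exact norm_eval_le_of_coeff_le hε (fun i => by rw [coeff_sub, norm_sub_rev]; exact hcoeff i)
      (hFr a' ha')
  exact absurd (hGa.trans hGa') (not_le.mpr hεδ)

/-- Under the hypotheses of `map_nearestRoot_eq_roots` (with `F` monic, the common degree `≥ 1` and the
roots of `G` in the closed unit ball, so that the matching exists), `G` has SIMPLE roots: "`g(X)` is
irreducible" in Gouvêa's Cor. 6.8.3 rests on this separation. [cite: Gouvea1993PadicNumbers, Cor 6.8.3] -/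
theorem nodup_roots_of_coeff_near (hFm : F.Monic) (hGm : G.Monic) (hFs : F.Splits) (hGs : G.Splits)
    (hdeg : G.natDegree = F.natDegree) (hn : F.natDegree ≠ 0) (hFnd : F.roots.Nodup)
    (hsep : ∀ a ∈ F.roots, ∀ a' ∈ F.roots, a ≠ a' → δ ≤ ‖a - a'‖) (hδ : 0 < δ) (hε : 0 ≤ ε)
    (hεδ : ε < δ ^ F.natDegree) (hcoeff : ∀ i, ‖F.coeff i - G.coeff i‖ ≤ ε)
    (hFr : ∀ a ∈ F.roots, ‖a‖ ≤ 1) (hGr : ∀ b ∈ G.roots, ‖b‖ ≤ 1) : G.roots.Nodup := by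
  classical
  choose! φ hφ using fun b (hb : b ∈ G.roots) =>
    exists_root_near_of_coeff_near hFm hFs hdeg hn hδ hε hεδ hcoeff hb (hGr b hb)
  have hmap := map_nearestRoot_eq_roots hGm hGs hFs hdeg hFnd hsep hδ hε hεδ hcoeff hFr
    (φ := φ) fun b hb => hφ b hb
  exact Multiset.Nodup.of_map φ (hmap ▸ hFnd)

/-- Under the same hypotheses the roots of `G` inherit the separation of the roots of `F`: distinct roots
of `G` are at distance `≥ δ` (so the argument can be iterated, and Krasner's lemma applies to `G` as well).
[cite: Gouvea1993PadicNumbers, Cor 6.8.3] -/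
theorem le_norm_sub_of_coeff_near (hFm : F.Monic) (hGm : G.Monic) (hFs : F.Splits) (hGs : G.Splits)
    (hdeg : G.natDegree = F.natDegree) (hn : F.natDegree ≠ 0) (hFnd : F.roots.Nodup)
    (hsep : ∀ a ∈ F.roots, ∀ a' ∈ F.roots, a ≠ a' → δ ≤ ‖a - a'‖) (hδ : 0 < δ) (hε : 0 ≤ ε)
    (hεδ : ε < δ ^ F.natDegree) (hcoeff : ∀ i, ‖F.coeff i - G.coeff i‖ ≤ ε)
    (hFr : ∀ a ∈ F.roots, ‖a‖ ≤ 1) (hGr : ∀ b ∈ G.roots, ‖b‖ ≤ 1) {b b' : L} (hb : b ∈ G.roots)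
    (hb' : b' ∈ G.roots) (hne : b ≠ b') : δ ≤ ‖b - b'‖ := by
  classical
  choose! φ hφ using fun b (hb : b ∈ G.roots) =>
    exists_root_near_of_coeff_near hFm hFs hdeg hn hδ hε hεδ hcoeff hb (hGr b hb)
  have hmap := map_nearestRoot_eq_roots hGm hGs hFs hdeg hFnd hsep hδ hε hεδ hcoeff hFr
    (φ := φ) fun b hb => hφ b hb
  have hinj : φ b ≠ φ b' := fun h => hne (Multiset.inj_on_of_nodup_map (hmap ▸ hFnd) b hb b' hb' h)
  have h1 : δ ≤ ‖φ b - φ b'‖ := hsep _ (hφ b hb).1 _ (hφ b' hb').1 hinj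
  -- `‖b - φ b'‖ = ‖φ b - φ b'‖ ≥ δ` and `‖b' - φ b'‖ < δ`, so `‖b' - b‖ = ‖φ b' - b‖ ≥ δ`
  have h2 : ‖b - φ b'‖ = ‖φ b - φ b'‖ := norm_sub_eq_of_lt_of_le (hφ b hb).2 h1
  have h3 : δ ≤ ‖φ b' - b‖ := by rw [norm_sub_rev, h2]; exact h1
  rw [norm_sub_rev, norm_sub_eq_of_lt_of_le (hφ b' hb').2 h3]
  exact h3

end Matching

/-! ### Krasner in both directions: matched roots generate the same extension -/

section Krasner

variable {K : Type*} [Field K] {L : Type*} [NormedField L] [Algebra K L]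
variable {f g : K[X]} {δ ε : ℝ}

/-- A conjugate (over `K`) of a root of `f` is a root of `f`. [cite: Gouvea1993PadicNumbers, Thm 6.8.2] -/
theorem mem_aroots_of_isConjRoot {x x' : L} (hf0 : f ≠ 0)
    (hx : x ∈ f.aroots L) (h : IsConjRoot K x x') : x' ∈ f.aroots L :=
  mem_aroots.mpr ⟨hf0, aeval_eq_zero_of_dvd_aeval_eq_zero (minpoly.dvd K x (mem_aroots.mp hx).2)
    h.aeval_eq_zero⟩

variable [IsUltrametricDist L] [IsKrasner K L]

/-- **Local constancy of the generated field** (Gouvêa, *p-adic Numbers*, Cor. 6.8.3 of Krasner's lemma;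
Cassels, *Local Fields*, Ch. 7 §3 Cor. 3): let `f, g ∈ K[X]` be monic of the same degree `n ≥ 1`, both split
in `L` (an extension with an ultrametric norm satisfying Krasner's lemma over `K`, e.g. `Q̄_p/ℚ_p`) with
roots in the closed unit ball, `f` separable with roots pairwise `≥ δ` apart, and
`‖f_i - g_i‖ ≤ ε < δ ^ n` for all coefficients. If `β` is a root of `g` and `α` the root of `f` within `< δ`
of `β`, then `K(β) = K(α)`. [cite: Gouvea1993PadicNumbers, Cor 6.8.3] -/
theorem adjoin_eq_adjoin_of_coeff_near (hfm : f.Monic) (hgm : g.Monic)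
    (hfs : (f.map (algebraMap K L)).Splits) (hgs : (g.map (algebraMap K L)).Splits)
    (hdeg : g.natDegree = f.natDegree) (hn : f.natDegree ≠ 0) (hfsep : f.Separable)
    (hsep : ∀ a ∈ f.aroots L, ∀ a' ∈ f.aroots L, a ≠ a' → δ ≤ ‖a - a'‖) (hδ : 0 < δ) (hε : 0 ≤ ε)
    (hεδ : ε < δ ^ f.natDegree)
    (hcoeff : ∀ i, ‖algebraMap K L (f.coeff i) - algebraMap K L (g.coeff i)‖ ≤ ε)
    (hfr : ∀ a ∈ f.aroots L, ‖a‖ ≤ 1) (hgr : ∀ b ∈ g.aroots L, ‖b‖ ≤ 1)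
    {β α : L} (hβ : β ∈ g.aroots L) (hα : α ∈ f.aroots L) (hβα : ‖β - α‖ < δ) :
    K⟮β⟯ = K⟮α⟯ := by
  -- the data of section `Matching` for `F := f.map _`, `G := g.map _`
  have hF0 : f.map (algebraMap K L) ≠ 0 := (hfm.map _).ne_zero
  have hG0 : g.map (algebraMap K L) ≠ 0 := (hgm.map _).ne_zero
  have hdeg' : (g.map (algebraMap K L)).natDegree = (f.map (algebraMap K L)).natDegree := by
    rw [hgm.natDegree_map, hfm.natDegree_map, hdeg]
  have hn' : (f.map (algebraMap K L)).natDegree ≠ 0 := by rwa [hfm.natDegree_map]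
  have hεδ' : ε < δ ^ (f.map (algebraMap K L)).natDegree := by rwa [hfm.natDegree_map]
  have hcoeff' : ∀ i, ‖(f.map (algebraMap K L)).coeff i - (g.map (algebraMap K L)).coeff i‖ ≤ ε :=
    fun i => by rw [coeff_map, coeff_map]; exact hcoeff i
  have hFnd : (f.map (algebraMap K L)).roots.Nodup := nodup_roots hfsep.map
  -- `g` is separable too
  have hGnd : (g.aroots L).Nodup :=
    nodup_roots_of_coeff_near (hfm.map _) (hgm.map _) hfs hgs hdeg' hn' hFnd hsep hδ hε hεδ' hcoeff'
      hfr hgr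
  have hgsep : g.Separable := (nodup_aroots_iff_of_splits hgm.ne_zero hgs).mp hGnd
  have hαf : aeval α f = 0 := (mem_aroots.mp hα).2
  have hβg : aeval β g = 0 := (mem_aroots.mp hβ).2
  have hαint : IsIntegral K α := ⟨f, hfm, by rw [← aeval_def]; exact hαf⟩
  have hβint : IsIntegral K β := ⟨g, hgm, by rw [← aeval_def]; exact hβg⟩
  -- Krasner for `x := α`, `y := β`: `α ∈ K⟮β⟯`
  have h1 : α ∈ K⟮β⟯ := by
    refine IsKrasner.krasner (K := K) (hfsep.of_dvd (minpoly.dvd K α hαf))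
      (hfs.of_dvd hF0 (Polynomial.map_dvd (algebraMap K L) (minpoly.dvd K α hαf))) hβint
      fun α' hconj hne => ?_
    rw [norm_sub_rev α β]
    exact hβα.trans_le (hsep α hα α' (mem_aroots_of_isConjRoot hfm.ne_zero hα hconj) hne)
  -- Krasner for `x := β`, `y := α`: `β ∈ K⟮α⟯`, using the inherited separation of the roots of `g`
  have h2 : β ∈ K⟮α⟯ := by
    refine IsKrasner.krasner (K := K) (hgsep.of_dvd (minpoly.dvd K β hβg))
      (hgs.of_dvd hG0 (Polynomial.map_dvd (algebraMap K L) (minpoly.dvd K β hβg))) hαint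
      fun β' hconj hne => ?_
    exact hβα.trans_le (le_norm_sub_of_coeff_near (hfm.map _) (hgm.map _) hfs hgs hdeg' hn' hFnd hsep
      hδ hε hεδ' hcoeff' hfr hgr hβ (mem_aroots_of_isConjRoot hgm.ne_zero hβ hconj) hne)
  exact le_antisymm (IntermediateField.adjoin_simple_le_iff.mpr h2)
    (IntermediateField.adjoin_simple_le_iff.mpr h1)

/-- **Local constancy, packaged** (Gouvêa Cor. 6.8.3): under the hypotheses of
`adjoin_eq_adjoin_of_coeff_near`, `g` is separable and every root `β` of `g` generates over `K` the same
subfield of `L` as some root `α` of `f` with `‖β - α‖ < δ`; in particular the fields generated by the roots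
of `g` are among the (at most `n`) fields generated by the roots of `f`.
[cite: Gouvea1993PadicNumbers, Cor 6.8.3] -/
theorem exists_adjoin_eq_of_coeff_near (hfm : f.Monic) (hgm : g.Monic)
    (hfs : (f.map (algebraMap K L)).Splits) (hgs : (g.map (algebraMap K L)).Splits)
    (hdeg : g.natDegree = f.natDegree) (hn : f.natDegree ≠ 0) (hfsep : f.Separable)
    (hsep : ∀ a ∈ f.aroots L, ∀ a' ∈ f.aroots L, a ≠ a' → δ ≤ ‖a - a'‖) (hδ : 0 < δ) (hε : 0 ≤ ε)
    (hεδ : ε < δ ^ f.natDegree)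
    (hcoeff : ∀ i, ‖algebraMap K L (f.coeff i) - algebraMap K L (g.coeff i)‖ ≤ ε)
    (hfr : ∀ a ∈ f.aroots L, ‖a‖ ≤ 1) (hgr : ∀ b ∈ g.aroots L, ‖b‖ ≤ 1) :
    g.Separable ∧ ∀ β ∈ g.aroots L, ∃ α ∈ f.aroots L, ‖β - α‖ < δ ∧ K⟮β⟯ = K⟮α⟯ := by
  have hdeg' : (g.map (algebraMap K L)).natDegree = (f.map (algebraMap K L)).natDegree := by
    rw [hgm.natDegree_map, hfm.natDegree_map, hdeg]
  have hn' : (f.map (algebraMap K L)).natDegree ≠ 0 := by rwa [hfm.natDegree_map]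
  have hεδ' : ε < δ ^ (f.map (algebraMap K L)).natDegree := by rwa [hfm.natDegree_map]
  have hcoeff' : ∀ i, ‖(f.map (algebraMap K L)).coeff i - (g.map (algebraMap K L)).coeff i‖ ≤ ε :=
    fun i => by rw [coeff_map, coeff_map]; exact hcoeff i
  have hFnd : (f.map (algebraMap K L)).roots.Nodup := nodup_roots hfsep.map
  refine ⟨(nodup_aroots_iff_of_splits hgm.ne_zero hgs).mp (nodup_roots_of_coeff_near (hfm.map _)
    (hgm.map _) hfs hgs hdeg' hn' hFnd hsep hδ hε hεδ' hcoeff' hfr hgr), fun β hβ => ?_⟩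
  obtain ⟨α, hα, hβα⟩ :=
    exists_root_near_of_coeff_near (hfm.map _) hfs hdeg' hn' hδ hε hεδ' hcoeff' hβ (hgr β hβ)
  exact ⟨α, hα, hβα, adjoin_eq_adjoin_of_coeff_near hfm hgm hfs hgs hdeg hn hfsep hsep hδ hε hεδ hcoeff
    hfr hgr hβ hα hβα⟩

end Krasner

end Literature.NumberTheory.LocalFields
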